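import Literature.Algebra.Lie.LefschetzModuleAdjoint
import Mathlib.LinearAlgebra.Eigenspace.Minpoly
import Mathlib.LinearAlgebra.Determinant
import Mathlib.LinearAlgebra.Projection
import Mathlib.Algebra.Polynomial.Roots
import HarnessLib

/-!
# The Lefschetz locus is Zariski open: generic elements of `𝔞` are Lefschetz and `dom f` spans `𝔞` (Looijenga–Lunts 1997, (1.1))

Topic `Literature/Algebra/Lie` (namespace `Literature.Algebra.Lie`).  Lane `lit-hodgefound` (Track 2 foundations
library), skeleton seat `lit-hodgefound-skel-1` (generation 41), row **A1-111** of
`run/shared/lean/pub/lit-hodgefound/SKELETON.md`: the remark of Looijenga–Lunts (1.1) that the Lefschetz locus in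
`𝔞` is Zariski open — left out of A1-88 (its SCOPE (a)) — in the form in which it is USED: along every line
`a + K b` through a Lefschetz `a` (with `b ∈ 𝔞`, i.e. of degree `2` and commuting with `a`) all but finitely many
points are Lefschetz; consequently the domain of the rational map `f` SPANS `𝔞` (for Lefschetz modules, A1-88, and
for Lefschetz triples, A1-84 — so "for `e` in the domain of `f`" statements determine everything linear in `𝔞`).
PROVED theorems only (no definition, no named fact, no `sorry`; D-0026 net debt `0`).  `LieRing.ofAssociativeRing` is
enabled FILE-LOCALLY as in the rest of the series.

## Source, VERBATIM

E. Looijenga, V. A. Lunts, *A Lie algebra attached to a projective variety*, Invent. Math. **129** (1997) 361–412,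
§1 (1.1) (held text `paper:arxiv-alg-geom_9604014` p0004 L28–L35):

> "Now let `𝔞` be a finite dimensional `K`-vector space. We regard `𝔞` as a graded abelian Lie algebra which is
> homogeneous of degree two. We say that a graded Lie homomorphism `e : 𝔞 → 𝔤𝔩(M)` has the Lefschetz property if
> for some `a ∈ 𝔞`, `e_a` has that property. Notice that the set of `a ∈ 𝔞` with the Lefschetz property is always
> Zariski open in `𝔞`. For `a` in this open set, we have defined the operator `f_a` such that `(e_a, h, f_a)` is
> `𝔰𝔩(2)`-triple. This defines a rational map `f : 𝔞 → 𝔤𝔩(M)` in the sense of algebraic geometry."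

## Rendering

No Zariski topology on `𝔞` is introduced.  "Zariski open (and non-empty, hence dense)" is rendered by its two
consequences that the lane uses: (1) RESTRICTED TO A LINE through a Lefschetz point the complement is finite
(`HasLefschetzProperty.finite_setOf_not_hasLefschetzProperty_add_smul`; level by level the bad `t` are roots of
the non-zero polynomial `det((a + t b)^k : M_{-k} → M_k)`), and (2) the Lefschetz locus `dom f` SPANS `𝔞`
(`span_lefschetzDomain_eq`, `IsLefschetzModule.span_lefschetzDomain`, `IsLefschetzTriple.span_lefschetzDomain`).

## Contents (all proved)

* `mapsTo_add_smul`; **`HasLefschetzProperty.finite_setOf_not_bijOn_add_smul_pow`** (fixed level `k`: a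
  projection `π : M → M_k` along a complement turns `g ↦ π ∘ g|_{M_{-k}}` into a LINEAR map to
  `Hom(M_{-k}, M_k)`; matrices in bases of `M_{-k}`, `M_k` (equidimensional by `a^k`); the binomial expansion of
  `(a + t b)^k` (`Commute.add_pow`) makes `det` a polynomial in `t` (`RingHom.map_det` for `Polynomial.evalRingHom`),
  non-zero at `t = 0` (`LinearEquiv.isUnit_det`), and `det ≠ 0` gives a bijection (`LinearEquiv.ofIsUnitDet`));
  **`HasLefschetzProperty.finite_setOf_not_hasLefschetzProperty_add_smul`** (union over the finitely many degrees,
  `Module.End.finite_hasEigenvalue`); `HasLefschetzProperty.exists_pair_hasLefschetzProperty_add_smul` (`K` is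
  infinite).
* **`span_lefschetzDomain_eq`** (`ℤ`-graded `(M, h)`, `h ≠ 0`, abelian `𝔞 ⊆ 𝔤𝔩(M)₂` with `dom f ≠ ∅`:
  `span (dom f) = 𝔞`, since `b = (t₁ - t₂)⁻¹((a + t₁ b) - (a + t₂ b))`), **`IsLefschetzModule.span_lefschetzDomain`**,
  **`IsLefschetzTriple.span_lefschetzDomain`** (through A1-101 `isLefschetzModule_ad`, `lefschetzDomain_map_ad` and
  the injectivity of `ad` on a semisimple `𝔤`).

## SCOPE (what is NOT formalised here)

(a) The Zariski topology / the statement "open" itself, and "rational map in the sense of algebraic geometry"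
(`f` stays the set-theoretic partial map of A1-84/A1-88).  (b) Nothing here concerns complex tori or the Hodge
conjecture.

## References

* [LooijengaLunts1997] E. Looijenga, V. A. Lunts, *A Lie algebra attached to a projective variety*, Invent. Math. 129
  (1997) 361–412; arXiv:alg-geom/9604014. §1 (1.1), p. 4 L28–L35 of the held text.
-/

namespace Literature.Algebra.Lie

open Module Function Set Polynomial

-- The commutator Lie ring of `𝔤𝔩(M) = Module.End K M`: Mathlib's reducible NON-instance, enabled file-locally
-- exactly as in `LefschetzModule.lean`.
attribute [local instance 100] LieRing.ofAssociativeRing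

section Pencil

variable {K : Type*} [Field K] {M : Type*} [AddCommGroup M] [Module K M] [FiniteDimensional K M]
  {h a b : Module.End K M}

omit [FiniteDimensional K M] in
/-- Operators of degree `2` form a subspace: `a + t b` has degree `2`. [cite: LooijengaLunts1997, §1 (1.1) p. 4 L28–L35] -/
theorem mapsTo_add_smul (ha : ∀ k : ℤ, MapsTo a (degreeSpace h k) (degreeSpace h (k + 2)))
    (hb : ∀ k : ℤ, MapsTo b (degreeSpace h k) (degreeSpace h (k + 2))) (t : K) (k : ℤ) :
    MapsTo (a + t • b) (degreeSpace h k) (degreeSpace h (k + 2)) := fun x hx ↦ by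
  rw [SetLike.mem_coe] at hx ⊢
  rw [LinearMap.add_apply, LinearMap.smul_apply]
  exact add_mem (ha k hx) (Submodule.smul_mem _ t (hb k hx))

/-- **The Lefschetz locus is Zariski open — along lines, level by level.**  If `a` has the Lefschetz property, `b` has
degree `2` and commutes with `a` (as in an abelian `𝔞`), then for every `k ≥ 0` the set of `t ∈ K` for which
`(a + t b)^k : M_{-k} → M_k` is NOT a bijection is finite: its members are roots of the polynomial
`t ↦ det((a + t b)^k : M_{-k} → M_k)` (matrices in bases of `M_{-k}`, `M_k`), which does not vanish at `t = 0`.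
[cite: LooijengaLunts1997, §1 (1.1) p. 4 L28–L35 ("the set of a ∈ 𝔞 with the Lefschetz property is always Zariski
open in 𝔞")] -/
theorem HasLefschetzProperty.finite_setOf_not_bijOn_add_smul_pow (L : HasLefschetzProperty h a)
    (hb : ∀ k : ℤ, MapsTo b (degreeSpace h k) (degreeSpace h (k + 2))) (hab : Commute a b) (k : ℕ) :
    {t : K | ¬ BijOn (⇑((a + t • b) ^ k)) (degreeSpace h (-(k : ℤ))) (degreeSpace h k)}.Finite := by
  classical
  set V : Submodule K M := degreeSpace h (-(k : ℤ)) with hV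
  set W : Submodule K M := degreeSpace h (k : ℤ) with hW
  -- every `(a + t b)^k` maps `M_{-k}` into `M_k`
  have hmaps : ∀ t : K, MapsTo ((a + t • b) ^ k) V W := fun t x hx ↦ by
    have h1 := pow_apply_mem_degreeSpace (mapsTo_add_smul L.mapsTo hb t) hx k
    rwa [show (-(k : ℤ)) + 2 * (k : ℕ) = (k : ℤ) by ring] at h1
  -- a projection `π : M → M_k` and the restriction operator `R g = π ∘ g|_{M_{-k}}`
  obtain ⟨W', hc⟩ := Submodule.exists_isCompl W
  let π : M →ₗ[K] W := W.projectionOnto W' hc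
  let R : Module.End K M → (V →ₗ[K] W) := fun g ↦ π ∘ₗ g ∘ₗ V.subtype
  have hR : ∀ g : Module.End K M, MapsTo g V W → ∀ x : V, (R g x : M) = g x := fun g hg x ↦ by
    show ((π (g x) : W) : M) = g x
    rw [Submodule.projectionOnto_apply_of_mem_left hc (hg x.2)]
  have hbij : ∀ g : Module.End K M, MapsTo g V W → Function.Bijective (R g) → BijOn g V W := by
    intro g hg hB
    refine ⟨hg, fun x hx y hy hxy ↦ ?_, fun y hy ↦ ?_⟩
    · have h1 : R g ⟨x, hx⟩ = R g ⟨y, hy⟩ := Subtype.ext (by rw [hR g hg, hR g hg]; exact hxy)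
      exact congrArg Subtype.val (hB.1 h1)
    · obtain ⟨⟨x, hx⟩, hx'⟩ := hB.2 ⟨y, hy⟩
      exact ⟨x, hx, by rw [← hR g hg ⟨x, hx⟩, hx']⟩
  have hbij' : ∀ g : Module.End K M, MapsTo g V W → BijOn g V W → Function.Bijective (R g) := by
    intro g hg hB
    refine ⟨fun x y hxy ↦ Subtype.ext (hB.injOn x.2 y.2 ?_), fun y ↦ ?_⟩
    · rw [← hR g hg x, ← hR g hg y, hxy]
    · obtain ⟨x, hx, hxy⟩ := hB.surjOn y.2
      exact ⟨⟨x, hx⟩, Subtype.ext (by rw [hR g hg]; exact hxy)⟩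
  -- bases of `M_{-k}` and `M_k` with the same index type
  have hak : Function.Bijective (R (a ^ k)) := hbij' _ (L.bijOn k).mapsTo (L.bijOn k)
  have hVW : finrank K V = finrank K W := LinearEquiv.finrank_eq (LinearEquiv.ofBijective (R (a ^ k)) hak)
  let bV := Module.finBasis K V
  let bW : Basis (Fin (finrank K V)) K W := (Module.finBasis K W).reindex (finCongr hVW.symm)
  let Θ : Module.End K M → Matrix (Fin (finrank K V)) (Fin (finrank K V)) K := fun g ↦ LinearMap.toMatrix bV bW (R g)
  -- non-vanishing determinant gives bijectivity
  have hdet : ∀ g : Module.End K M, MapsTo g V W → (Θ g).det ≠ 0 → BijOn g V W := by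
    intro g hg hd
    refine hbij g hg ?_
    have hu : IsUnit (LinearMap.toMatrix bV bW (R g)).det := isUnit_iff_ne_zero.2 hd
    have he : ((LinearEquiv.ofIsUnitDet hu : V ≃ₗ[K] W) : V →ₗ[K] W) = R g := LinearEquiv.coe_ofIsUnitDet hu
    have h1 := (LinearEquiv.ofIsUnitDet hu).bijective
    rwa [← LinearEquiv.coe_coe, he] at h1
  -- the binomial expansion of `(a + t b)^k`
  let G : ℕ → Module.End K M := fun j ↦ a ^ j * b ^ (k - j) * (k.choose j : Module.End K M)
  have hexp : ∀ t : K, (a + t • b) ^ k = ∑ j ∈ Finset.range (k + 1), t ^ (k - j) • G j := fun t ↦ by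
    rw [(hab.smul_right t).add_pow]
    refine Finset.sum_congr rfl fun j _ ↦ ?_
    rw [smul_pow, mul_smul_comm, smul_mul_assoc]
  have hRsum : ∀ c : ℕ → K, R (∑ j ∈ Finset.range (k + 1), c j • G j) = ∑ j ∈ Finset.range (k + 1), c j • R (G j) := by
    intro c
    apply LinearMap.ext
    intro x
    simp only [R, LinearMap.comp_apply, LinearMap.sum_apply, LinearMap.smul_apply, map_sum, map_smul]
  have hΘ : ∀ t : K, Θ ((a + t • b) ^ k) = ∑ j ∈ Finset.range (k + 1), t ^ (k - j) • Θ (G j) := fun t ↦ by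
    simp only [Θ, hexp t, hRsum, map_sum, map_smul]
  -- the determinant polynomial
  let Q : K[X] := Matrix.det fun i i' ↦ ∑ j ∈ Finset.range (k + 1), C (Θ (G j) i i') * X ^ (k - j)
  have hQ : ∀ t : K, Q.eval t = (Θ ((a + t • b) ^ k)).det := fun t ↦ by
    rw [hΘ t]
    show (evalRingHom t) (Matrix.det _) = _
    rw [RingHom.map_det]
    congr 1
    ext i i'
    simp only [RingHom.mapMatrix_apply, Matrix.map_apply, coe_evalRingHom, eval_finsetSum, eval_mul, eval_C,
      eval_pow, eval_X, Matrix.sum_apply, Matrix.smul_apply, smul_eq_mul, mul_comm]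
  have hQ0 : Q ≠ 0 := by
    intro h0
    have h1 := hQ 0
    rw [h0, eval_zero, zero_smul, add_zero] at h1
    have h2 : IsUnit (LinearMap.toMatrix bV bW ((LinearEquiv.ofBijective (R (a ^ k)) hak : V ≃ₗ[K] W) :
        V →ₗ[K] W)).det := LinearEquiv.isUnit_det _ _ _
    exact h2.ne_zero h1.symm
  -- conclusion
  refine (Q.roots.toFinset.finite_toSet).subset fun t ht ↦ ?_
  rw [Set.mem_setOf_eq] at ht
  rw [Finset.mem_coe, Multiset.mem_toFinset, mem_roots hQ0, IsRoot.def, hQ t]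
  by_contra hd
  exact ht (hdet _ (hmaps t) hd)

/-- **The Lefschetz locus is Zariski open — along lines.**  If `a` has the Lefschetz property and `b` is an operator
of degree `2` commuting with `a`, then `a + t b` has the Lefschetz property for all but finitely many `t ∈ K`.
[cite: LooijengaLunts1997, §1 (1.1) p. 4 L28–L35] -/
theorem HasLefschetzProperty.finite_setOf_not_hasLefschetzProperty_add_smul [CharZero K]
    (L : HasLefschetzProperty h a) (hb : ∀ k : ℤ, MapsTo b (degreeSpace h k) (degreeSpace h (k + 2)))
    (hab : Commute a b) : {t : K | ¬ HasLefschetzProperty h (a + t • b)}.Finite := by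
  -- only finitely many degrees `-k` occur
  have hS : {k : ℕ | degreeSpace h (-(k : ℤ)) ≠ ⊥}.Finite := by
    have h1 := Module.End.finite_hasEigenvalue h
    refine (h1.preimage (f := fun k : ℕ ↦ (((-(k : ℤ) : ℤ)) : K)) fun x _ y _ hxy ↦ ?_).subset fun k hk ↦ ?_
    · simp only [Int.cast_neg, Int.cast_natCast, neg_inj, Nat.cast_inj] at hxy
      exact hxy
    · exact hk
  refine (hS.biUnion fun k _ ↦ L.finite_setOf_not_bijOn_add_smul_pow hb hab k).subset fun t ht ↦ ?_
  rw [Set.mem_setOf_eq] at ht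
  by_contra hcon
  apply ht
  refine ⟨fun j ↦ mapsTo_add_smul L.mapsTo hb t j, fun k ↦ ?_⟩
  by_cases hk : degreeSpace h (-(k : ℤ)) = ⊥
  · -- `M_{-k} = 0`, hence `M_k = a^k M_{-k} = 0`: nothing to check
    have hk' : degreeSpace h (k : ℤ) = ⊥ := by
      rw [eq_bot_iff]
      intro y hy
      obtain ⟨x, hx, rfl⟩ := (L.bijOn k).surjOn hy
      rw [SetLike.mem_coe, hk, Submodule.mem_bot] at hx
      rw [hx, map_zero]
      exact zero_mem _
    rw [hk, hk', Submodule.bot_coe]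
    refine ⟨fun x hx ↦ ?_, fun x hx y hy _ ↦ ?_, fun y hy ↦ ⟨0, rfl, ?_⟩⟩
    · rw [Set.mem_singleton_iff] at hx
      rw [hx, Set.mem_singleton_iff, map_zero]
    · rw [Set.mem_singleton_iff] at hx hy
      rw [hx, hy]
    · rw [Set.mem_singleton_iff] at hy
      rw [hy, map_zero]
  · by_contra hbad
    exact hcon (Set.mem_biUnion hk hbad)

/-- Hence (the field being infinite) **two distinct points of the line `a + K b` are Lefschetz**.
[cite: LooijengaLunts1997, §1 (1.1) p. 4 L28–L35] -/
theorem HasLefschetzProperty.exists_pair_hasLefschetzProperty_add_smul [CharZero K]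
    (L : HasLefschetzProperty h a) (hb : ∀ k : ℤ, MapsTo b (degreeSpace h k) (degreeSpace h (k + 2)))
    (hab : Commute a b) :
    ∃ t₁ t₂ : K, t₁ ≠ t₂ ∧ HasLefschetzProperty h (a + t₁ • b) ∧ HasLefschetzProperty h (a + t₂ • b) := by
  haveI : Infinite K := Infinite.of_injective _ Nat.cast_injective
  have hinf := (L.finite_setOf_not_hasLefschetzProperty_add_smul hb hab).infinite_compl
  obtain ⟨t₁, ht₁⟩ := hinf.nonempty
  obtain ⟨t₂, ht₂⟩ := (hinf.sdiff (Set.finite_singleton t₁)).nonempty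
  rw [Set.mem_sdiff, Set.mem_singleton_iff] at ht₂
  rw [Set.mem_compl_iff, Set.mem_setOf_eq, not_not] at ht₁
  rw [Set.mem_compl_iff, Set.mem_setOf_eq, not_not] at ht₂
  exact ⟨t₁, t₂, Ne.symm ht₂.2, ht₁, ht₂.1⟩

end Pencil

/-! ## The domain of `f` spans `𝔞` -/

section Span

variable {K : Type*} [Field K] [CharZero K] {M : Type*} [AddCommGroup M] [Module K M] [FiniteDimensional K M]
  {h : Module.End K M} {𝔞 : Submodule K (Module.End K M)}

/-- **The domain of the rational map `f : 𝔞 → 𝔤𝔩(M)` spans `𝔞`** (it is a non-empty Zariski-open subset): for a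
`ℤ`-graded `(M, h)` (`h ≠ 0`) and an abelian `𝔞 ⊆ 𝔤𝔩(M)₂` containing one Lefschetz operator, every `b ∈ 𝔞` is a
combination of two Lefschetz elements `a + t₁ b`, `a + t₂ b` of `𝔞`. [cite: LooijengaLunts1997, §1 (1.1) p. 4 L28–L35] -/
theorem span_lefschetzDomain_eq (hgr : IsZGrading h) (h0 : h ≠ 0) (h2 : 𝔞 ≤ adDegree K h 2)
    (hcomm : ∀ a ∈ 𝔞, ∀ b ∈ 𝔞, ⁅a, b⁆ = 0) (hne : (lefschetzDomain K h 𝔞).Nonempty) :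
    Submodule.span K (lefschetzDomain K h 𝔞) = 𝔞 := by
  refine le_antisymm (Submodule.span_le.2 fun e he ↦ he.1) fun b hb ↦ ?_
  obtain ⟨a, ha, f, t⟩ := hne
  have L : HasLefschetzProperty h a := hasLefschetzProperty_of_isSl2Triple hgr t
  have hdeg : ∀ x ∈ 𝔞, ∀ k : ℤ, MapsTo x (degreeSpace h k) (degreeSpace h (k + 2)) := fun x hx ↦
    mapsTo_of_lie_eq_two_nsmul (by rw [mem_adDegree_iff.1 (h2 hx), ofNat_smul_eq_nsmul])
  have hab : Commute a b := by
    have h1 := hcomm a ha b hb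
    rw [Ring.lie_def, sub_eq_zero] at h1
    exact h1
  obtain ⟨t₁, t₂, hne, L₁, L₂⟩ := L.exists_pair_hasLefschetzProperty_add_smul (hdeg b hb) hab
  have hmem : ∀ s : K, HasLefschetzProperty h (a + s • b) → a + s • b ∈ lefschetzDomain K h 𝔞 := fun s Ls ↦
    ⟨add_mem ha (Submodule.smul_mem _ s hb), Ls.exists_isSl2Triple hgr h0⟩
  have hb' : b = (t₁ - t₂)⁻¹ • ((a + t₁ • b) - (a + t₂ • b)) := by
    rw [add_sub_add_left_eq_sub, ← sub_smul, smul_smul, inv_mul_cancel₀ (sub_ne_zero.2 hne), one_smul]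
  rw [hb']
  exact Submodule.smul_mem _ _ (sub_mem (Submodule.subset_span (hmem t₁ L₁)) (Submodule.subset_span (hmem t₂ L₂)))

/-- **For a Lefschetz module `(𝔞, M)` the Lefschetz elements span `𝔞`.** [cite: LooijengaLunts1997, §1 (1.1) p. 4 L28–L35] -/
theorem IsLefschetzModule.span_lefschetzDomain (A : IsLefschetzModule K h 𝔞) :
    Submodule.span K (lefschetzDomain K h 𝔞) = 𝔞 := by
  obtain ⟨e, he, f, t⟩ := A.nonempty_lefschetzDomain
  exact span_lefschetzDomain_eq A.isZGrading t.h_ne_zero A.le_adDegree_two A.lie_eq_zero ⟨e, he, f, t⟩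

end Span

/-! ## The same for Lefschetz triples: `dom f` spans `𝔞 ⊆ 𝔤` -/

section Triple

variable {K : Type*} [Field K] [CharZero K] {L : Type*} [LieRing L] [LieAlgebra K L] [FiniteDimensional K L]
  {h : L} {𝔞 : Submodule K L}

/-- **For a Lefschetz triple `(𝔤, h, 𝔞)` the domain of `f` spans `𝔞`** — via the adjoint representation (A1-101
§3: `(ad 𝔞, 𝔤)` is a Lefschetz module, `dom f` corresponds under the injective `ad`).
[cite: LooijengaLunts1997, §1 (1.1) p. 4 L28–L35; p. 7 L61–L66 (Lefschetz triple, (i))] -/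
theorem IsLefschetzTriple.span_lefschetzDomain (T : IsLefschetzTriple K h 𝔞) :
    Submodule.span K (lefschetzDomain K h 𝔞) = 𝔞 := by
  haveI := T.isSemisimple
  have hinj : Function.Injective (LieAlgebra.ad K L : L →ₗ[K] Module.End K L) :=
    LieModule.IsFaithful.injective_toEnd (R := K) (L := L) (M := L)
  have h1 := T.isLefschetzModule_ad.span_lefschetzDomain
  have h2 : (⇑(LieAlgebra.ad K L) '' lefschetzDomain K h 𝔞) =
      ⇑(LieAlgebra.ad K L : L →ₗ[K] Module.End K L) '' lefschetzDomain K h 𝔞 := rfl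
  rw [lefschetzDomain_map_ad, h2, Submodule.span_image] at h1
  exact Submodule.map_injective_of_injective hinj h1

end Triple

end Literature.Algebra.Lie
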